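import Summits.BirchSwinnertonDyer.BirchSwinnertonDyer.Theorems.AdditiveBranchIMCGordTwoTwistedReciprocity
import HarnessLib

/-!
# The twisted Wan road (crux 19357, design D2 of FieldTwoTwisted): sign bookkeeping for the auxiliary twist (LEAD g15)

Theorems only, pure arithmetic: `χ₄(|d_K ℓ₀*|) = −(−1/p)` when `d_K < 0`, `d_K ≡ ℓ₀* ≡ 1 (mod 4)` and `sign ℓ₀* = sign p*`
(`χ₄_natAbs_discr_mul_eq`), and `p* ≡ 1 (mod 8)` for `p ≡ ±1 (mod 8)` (`pStar_emod_eight_of`). Used by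
`TwistedWanRoad.exists_auxTwist_twisted`. References: [IrelandRosen1990] Ch. 5 §1–§2.
-/

set_option linter.dupNamespace false
set_option autoImplicit false

open scoped Classical

namespace Summit.BirchSwinnertonDyer.BirchSwinnertonDyer.Theorems.TwistedWanRoad

open NumberTheorySymbols

/-! ### §1 The sign bookkeeping -/

/-- `χ₄(|d_K ℓ₀*|) = −(−1/p)` when `d_K < 0`, `d_K ≡ ℓ₀* ≡ 1 (mod 4)` and `sign ℓ₀* = sign p*`. [folklore] -/
theorem χ₄_natAbs_discr_mul_eq {dK : ℤ} {p ℓ₀ : ℕ} (hp : p.Prime) (hp2 : p ≠ 2) (hℓ₀ : ℓ₀.Prime)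
    (hdKneg : dK < 0) (hdK4 : dK % 4 = 1) (hls4 : ((-1 : ℤ) ^ (ℓ₀ / 2) * ℓ₀) % 4 = 1)
    (hσ : (-1 : ℤ) ^ (ℓ₀ / 2) = (-1 : ℤ) ^ (p / 2)) :
    ZMod.χ₄ ((dK * ((-1 : ℤ) ^ (ℓ₀ / 2) * ℓ₀)).natAbs : ZMod 4) = - J(-1 | p) := by
  have hpodd : p % 2 = 1 := hp.eq_two_or_odd.resolve_left hp2
  have hℓ₀pos : (0 : ℤ) < ℓ₀ := by exact_mod_cast hℓ₀.pos
  rw [jacobiSym.at_neg_one (Nat.odd_iff.mpr hpodd)]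
  set D : ℤ := dK * ((-1 : ℤ) ^ (ℓ₀ / 2) * ℓ₀) with hD
  have hD4 : D % 4 = 1 := by rw [hD, Int.mul_emod, hdK4, hls4]; decide
  rcases Nat.odd_mod_four_iff.mp hpodd with hp4 | hp4
  · -- `p ≡ 1 (4)`: `ℓ₀* = ℓ₀ > 0`, `D < 0`, `|D| ≡ 3 (4)`
    rw [ZMod.χ₄_nat_one_mod_four hp4]
    rw [ZMod.neg_one_pow_div_two_of_one_mod_four hp4] at hσ
    have hDneg : D < 0 := by
      rw [hD, hσ, one_mul]; exact mul_neg_of_neg_of_pos hdKneg hℓ₀pos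
    have h3 : D.natAbs % 4 = 3 := by omega
    rw [ZMod.χ₄_nat_three_mod_four h3]
  · -- `p ≡ 3 (4)`: `ℓ₀* = −ℓ₀ < 0`, `D > 0`, `|D| ≡ 1 (4)`
    rw [ZMod.χ₄_nat_three_mod_four hp4, neg_neg]
    rw [ZMod.neg_one_pow_div_two_of_three_mod_four hp4] at hσ
    have hDpos : 0 < D := by
      rw [hD, hσ, show dK * (-1 * (ℓ₀ : ℤ)) = (-dK) * ℓ₀ by ring]
      exact mul_pos (neg_pos.mpr hdKneg) hℓ₀pos
    have h1 : D.natAbs % 4 = 1 := by omega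
    rw [ZMod.χ₄_nat_one_mod_four h1]

/-- `p*` modulo `8` is `1` when `p ≡ ±1 (mod 8)`. [folklore] -/
theorem pStar_emod_eight_of {p : ℕ} (hp : p.Prime) (h8 : p % 8 = 1 ∨ p % 8 = 7) :
    ((-1 : ℤ) ^ (p / 2) * p) % 8 = 1 := by
  rcases h8 with h | h
  · have hp4 : p % 4 = 1 := by omega
    rw [ZMod.neg_one_pow_div_two_of_one_mod_four hp4, one_mul]
    have : (p : ℤ) % 8 = 1 := by exact_mod_cast h
    exact this
  · have hp4 : p % 4 = 3 := by omega
    rw [ZMod.neg_one_pow_div_two_of_three_mod_four hp4]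
    have : (p : ℤ) % 8 = 7 := by exact_mod_cast h
    have _ := hp.pos
    omega

end Summit.BirchSwinnertonDyer.BirchSwinnertonDyer.Theorems.TwistedWanRoad
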